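import Summits.BirchSwinnertonDyer.BirchSwinnertonDyer.Theses.TameQuarticManinParity
import Literature.NumberTheory.ModularSymbols.CuspidalHomologyPrymFixedPointSpan
import HarnessLib

/-!
# Route `TameQuarticManinParity`: E32a `PrymLatticeFixedPointSpan` (stmt-BirchSwinnertonDyer-23756) BY NAME,
# modulo Knapp's integral presentation of `H₁(X₀(N), ℤ)` by periods (named fact
# `periodFunctional_ker_le_ellipticParabolic_sup_commutator`, Knapp 1993 Prop. 11.22)

Lead seat `cruxlead-stmt-BirchSwinnertonDyer-23367` (crux MS, line `abelian-fixed-points`), landing the by-name reading of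
typer tqmp-ty1 g30's Literature theorem `Literature.NumberTheory.ModularSymbols.prymLatticeFixedPointSpan_of_periodKernelFact`
(p678944, `CuspidalHomologyPrymFixedPointSpan`: lifted symbols `{∞, (g∞)/3}` on `Γ₀(N/3)`, crossed-homomorphism rule, coset
decomposition `Γ₀(N/3) = ⋃ Tⁱ·DΓ₀(N)D⁻¹`, fixed-point symbols of parabolic/elliptic elements; the one INTEGRAL input is
Knapp's Prop. 11.22 at level `N/3`). CONDITIONAL RESULT: E32a holds granted that named fact (its body is the hypothesis
`H`). THEOREMS ONLY; no definition, no new named fact, no `sorry`. No summit is proved; BSD is NOT proved.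
-/

set_option autoImplicit false
-- D-0017: single-problem summit, so `Summit.BirchSwinnertonDyer.BirchSwinnertonDyer.…` repeats a namespace BY DESIGN.
set_option linter.dupNamespace false

noncomputable section

namespace Summit.BirchSwinnertonDyer.BirchSwinnertonDyer.Theorems.TameQuarticManinParity

open Summit.BirchSwinnertonDyer.BirchSwinnertonDyer.Theses.TameQuarticManinParity
open Literature.NumberTheory.ModularSymbols

/-- **E32a `PrymLatticeFixedPointSpan` (stmt-BirchSwinnertonDyer-23756) by name, GRANTED Knapp's presentation**
(`periodFunctional_ker_le_ellipticParabolic_sup_commutator`): for every `N` with `9 ∣ N`, the Prym lattice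
`Λ_P = ker Nm` lies in `(t − 1)Λ + ℤ{ {∞, γ∞} : γ ∈ Γ₀(N), |3(a + d) − c| ≤ 6 }`.
[cite: Knapp1993, Prop. 11.22 (PDF p. 242)] -/
theorem prymLatticeFixedPointSpan_of_periodKernelFact
    (H : periodFunctional_ker_le_ellipticParabolic_sup_commutator) : PrymLatticeFixedPointSpan :=
  fun N _ h9 ↦ Literature.NumberTheory.ModularSymbols.prymLatticeFixedPointSpan_of_periodKernelFact H N h9

end Summit.BirchSwinnertonDyer.BirchSwinnertonDyer.Theorems.TameQuarticManinParity

end
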